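import Summits.FinalStateConjecture.FinalStateConjecture.Theorems.SwallowTheDatumKerrShieldedDataExistCapChart
import Summits.FinalStateConjecture.FinalStateConjecture.Theorems.SwallowTheDatumKerrShieldedDataExistCapReparam
import Summits.FinalStateConjecture.FinalStateConjecture.Theorems.KerrShieldedDataExist.Negative.SliceClause
import Literature.Geometry.Lorentzian.UnitNormalUniqueness
import Literature.Geometry.Lorentzian.LeviCivitaProofs
import HarnessLib

/-!
# `KerrShieldedDataExist`, line `plug-the-second-sheet` (skeleton v4 "KerrCap") — stub `stub_capShield`:
# the shielding block of the crux for the glued datum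

Support file (`--supports stmt-FinalStateConjecture-10055`; everything proved, no definitions, no named facts):
the registered stub `stub_capShield` of `Cruxes/KerrShieldedDataExist/Lines/plug_the_second_sheet.lean`, proved
verbatim. The datum `C` on `E3` IS, on `Ω = {‖u‖ > σ}`, the datum induced by the cap map
`Ψ u = (τ(s), X u)`, `s = ‖u‖`, `X u = L_{ϱ(s)} Rot_z(α(s)) (u/s)`, into the ingoing Kerr–Schild chart
`Kerr.region a r_c` with its future unit normal `N`: `C.h = Ψ^* g`, `C.k = K_N(Ψ)`. On the graph zone `s ≥ σ₄`
the profiles are `τ = T_{M,a} ∘ ϱ + c`, `ϱ′ > 0` with inverse `ϱ⁻¹` on `(r_b, ∞)`. The crux's shielding block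
holds for `C` with `(M, a)`, junction radius `r₁ = r_b ∈ (r₋, r₊)`, the literal height `T = Negative.bentHeight M a`,
the pinned graph `ψ = Negative.graph M a r_b` with its future unit normal `ν = Negative.graphNormal M a r_b`
(conjuncts 8–9: `Negative.isSpacelikeImmersion_graph`, `Negative.isFutureUnitNormal_graphNormal`, in the tree), and
the END CHART `φ(x⃗) = ϱ⁻¹(r) · Rot_z(−α(ϱ⁻¹ r)) ℓ⃗(x⃗)` of `…CapChart` (range `{‖u‖ > σ₄}` with compact
complement `closedBall 0 σ₄`, open embedding, `C^∞`; `X ∘ φ = id`):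

* `Ψ ∘ φ = ψ + c ∂_{t*}` pointwise on the slice (`τ(ϱ⁻¹ r) = T(r) + c`, `X (φ x⃗) = x⃗`), whence by the chain rule
  (`KerrCap.pullbackBilin_comp_of_repr`), `t*`-translation invariance (`Kerr.pullbackBilin_timeTranslate`) and
  chart independence (`KerrCap.pullbackBilin_kerrChart_eq`) the pull-back identity `φ^* C.h = ψ^* g`;
* the field `N ∘ φ` is the future unit normal of `Ψ ∘ φ` (`KerrCap.isFutureUnitNormal_comp`), hence of `ψ`
  (`Kerr.isFutureUnitNormal_timeTranslate`, `KerrCap.isFutureUnitNormal_kerrChart`), hence EQUALS `graphNormal`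
  (`IsFutureUnitNormal.unique`, `finrank E4 = finrank E3 + 1`); with the reparametrisation naturality of the
  second fundamental form (`KerrCap.secondFundamentalForm_comp_of_repr`), its `t*`-translation invariance
  (`Kerr.secondFundamentalForm_timeTranslate`) and chart independence (`KerrCap.secondFundamentalForm_kerrChart_eq`)
  this gives `φ^* C.k = K_ν(ψ)`.

References: B. O'Neill, *Semi-Riemannian geometry* (1983), Ch. 4, Lemma 4.4, Prop. 4.8; Ch. 5, p. 145;
Ch. 9, pp. 255–256; M. Dafermos, I. Rodnianski, arXiv:0811.0354, §5.1; R. M. Wald (1984), §10.2.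
-/

-- the doubled `FinalStateConjecture` path component is the summit/problem naming scheme, not a mistake
set_option linter.dupNamespace false

-- instance search through the nested operator type `E4 →L[ℝ] E4 →L[ℝ] ℝ` (as in the tree files)
set_option maxSynthPendingDepth 3

noncomputable section

open Set Function Filter Topology TopologicalSpace
open scoped Manifold ContDiff Topology InnerProductSpace
open Literature.Geometry.Lorentzian
open Summit.FinalStateConjecture.FinalStateConjecture.Theorems.KerrShieldedDataExist

namespace Summit.FinalStateConjecture.FinalStateConjecture.Theorems.SwallowTheDatum

namespace KerrCap

/-- `(s + t, y) = (s, y) + t ∂_{t*}` in the Kerr–Schild chart. [folklore] -/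
theorem ofTimeSpace_add_eq (s t : ℝ) (y : E3) :
    E4.ofTimeSpace (s + t) y = E4.ofTimeSpace s y + t • E4.basisVector 0 := by
  rw [E4.ofTimeSpace_eq_smul_add', E4.ofTimeSpace_eq_smul_add', add_smul]
  abel

end KerrCap

/-- **Stub `stub_capShield` of the line `plug-the-second-sheet` (v4 "KerrCap"), proved verbatim**: a datum `C` on
`E3` which on `Ω = {‖u‖ > σ}` IS the induced datum of the cap map satisfies the crux's shielding block with
`(M, a)`, `r₁ = r_b`, the literal height, `ψ = Negative.graph M a r_b`, `ν = Negative.graphNormal M a r_b` and the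
end chart `φ(x⃗) = ϱ⁻¹(r) · Rot_z(−α(ϱ⁻¹ r)) ℓ⃗(x⃗)` (inverse of `X` on the graph zone, `…CapChart`); the pull-back
identities are the chain rule, the `t*`-translation invariance of the Kerr–Schild data (`Ψ ∘ φ = ψ + c ∂_{t*}`),
chart independence, and — for `k` — the uniqueness of the future unit normal and the reparametrisation naturality
of `K_ν` (`…CapReparam`). [cite: ONeill1983, Ch. 4, Lemma 4.4] [cite: arXiv08110354, §5.1] -/
theorem stub_capShield :
    ∀ [Kerr.Facts] (M a σ σ₄ c rb rc : ℝ) (hM : 0 ≤ M) (τ ϱ α ϱinv : ℝ → ℝ) (X : E3 → E3)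
      (Ω : Opens E3) (Ψ : Ω → Kerr.region a rc) (N : E3 → E4) (C : InitialDataSet (𝓡 3) E3),
      |a| < M → Kerr.rMinus M a < rb → rb < Kerr.rPlus M a → 0 ≤ rc → rc ≤ rb → 0 < σ → σ < σ₄ →
      ContDiff ℝ ∞ τ → ContDiff ℝ ∞ ϱ → ContDiff ℝ ∞ α →
      (∀ s, σ₄ ≤ s → τ s = Negative.bentHeight M a (ϱ s) + c ∧ 0 < deriv ϱ s) →
      (∀ s, σ₄ < s → rb < ϱ s ∧ ϱinv (ϱ s) = s) →
      (∀ r, rb < r → σ₄ < ϱinv r ∧ ϱ (ϱinv r) = r) →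
      ContDiffOn ℝ ∞ ϱinv (Set.Ioi rb) →
      (∀ u : E3, X u =
        !₂[(ϱ ‖u‖ * (Real.cos (α ‖u‖) * u 0 - Real.sin (α ‖u‖) * u 1) -
              a * (Real.sin (α ‖u‖) * u 0 + Real.cos (α ‖u‖) * u 1)) / ‖u‖,
           (ϱ ‖u‖ * (Real.sin (α ‖u‖) * u 0 + Real.cos (α ‖u‖) * u 1) +
              a * (Real.cos (α ‖u‖) * u 0 - Real.sin (α ‖u‖) * u 1)) / ‖u‖,
           ϱ ‖u‖ * u 2 / ‖u‖]) →
      (Ω : Set E3) = {u : E3 | σ < ‖u‖} →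
      (∀ u : Ω, (Ψ u : E4) = E4.ofTimeSpace (τ ‖(u : E3)‖) (X u)) →
      (Kerr.smoothMetric M a rc).IsSpacelikeImmersion 𝓘(ℝ, E3) Ψ → ContDiffOn ℝ ∞ N Ω →
      (Kerr.smoothMetric M a rc).IsFutureUnitNormal 𝓘(ℝ, E3)
        ((Kerr.timeOrientation M a rc hM).ofLE le_top) Ψ (fun u ↦ N u) →
      (∀ (u : Ω) (v w : E3), C.h.inner (u : E3) v w =
          (Kerr.smoothMetric M a rc).inducedBilin 𝓘(ℝ, E3) Ψ u v w) →
      (∀ [(Kerr.smoothMetric M a rc).HasLeviCivita] (u : Ω) (v w : E3), C.k (u : E3) v w =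
          (Kerr.smoothMetric M a rc).secondFundamentalForm 𝓘(ℝ, E3) Ψ (fun u ↦ N u) u v w) →
      ∃ (a' r₁ : ℝ) (hM' : 0 ≤ M) (T : ℝ → ℝ) (φ : Literature.Geometry.Lorentzian.Kerr.slice a' r₁ → Literature.Geometry.Lorentzian.E3) (ψ : Literature.Geometry.Lorentzian.Kerr.slice a' r₁ → Literature.Geometry.Lorentzian.Kerr.region a' r₁) (ν : Literature.Geometry.Lorentzian.NormalField 𝓘(ℝ, Literature.Geometry.Lorentzian.E4) ψ), |a'| < M ∧ Literature.Geometry.Lorentzian.Kerr.rMinus M a' < r₁ ∧ r₁ < Literature.Geometry.Lorentzian.Kerr.rPlus M a' ∧ T = (fun r : ℝ => Real.smoothTransition (r / (4 * M) - 1) * (((M) / Real.sqrt ((M) ^ 2 - (a') ^ 2)) * (Literature.Geometry.Lorentzian.Kerr.rPlus M a' * Real.log (r - Literature.Geometry.Lorentzian.Kerr.rPlus M a') - Literature.Geometry.Lorentzian.Kerr.rMinus M a' * Real.log (r - Literature.Geometry.Lorentzian.Kerr.rMinus M a')) - ((M) / Real.sqrt ((M) ^ 2 - (a') ^ 2)) *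 (Literature.Geometry.Lorentzian.Kerr.rPlus M a' * Real.log ((4 * M) - Literature.Geometry.Lorentzian.Kerr.rPlus M a') - Literature.Geometry.Lorentzian.Kerr.rMinus M a' * Real.log ((4 * M) - Literature.Geometry.Lorentzian.Kerr.rMinus M a')))) ∧ IsCompact (Set.range φ)ᶜ ∧ Topology.IsOpenEmbedding φ ∧ ContMDiff 𝓘(ℝ, Literature.Geometry.Lorentzian.E3) (𝓡 3) ((⊤ : ℕ∞) : WithTop ℕ∞) φ ∧ (∀ y : Literature.Geometry.Lorentzian.Kerr.slice a' r₁, (ψ y : Literature.Geometry.Lorentzian.E4) = Literature.Geometry.Lorentzian.E4.ofTimeSpace (T (Literature.Geometry.Lorentzian.Kerr.radius a' (Literature.Geometry.Lorentzian.E4.ofTimeSpace 0 (y : Literature.Geometry.Lorentzian.E3)))) (y : Literature.Geometry.Lorentzian.E3)) ∧ (Literature.Geometry.Lorentzian.Kerr.smoothMetric M a' r₁).IsSpacelikeImmersion 𝓘(ℝ, Literature.Geometry.Lorentzian.E3) ψ ∧ (Literature.Geometry.Lorentzian.Kerr.smoothMetric M a' r₁).IsFutureUnitNormal 𝓘(ℝ,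 Literature.Geometry.Lorentzian.E3) ((Literature.Geometry.Lorentzian.Kerr.timeOrientation M a' r₁ hM').ofLE le_top) ψ ν ∧ (∀ y : Literature.Geometry.Lorentzian.Kerr.slice a' r₁, Literature.Geometry.Lorentzian.pullbackBilin (I := 𝓡 3) (I' := 𝓘(ℝ, Literature.Geometry.Lorentzian.E3)) φ (C).h.inner y = Literature.Geometry.Lorentzian.pullbackBilin (I := 𝓘(ℝ, Literature.Geometry.Lorentzian.E4)) (I' := 𝓘(ℝ, Literature.Geometry.Lorentzian.E3)) ψ (Literature.Geometry.Lorentzian.Kerr.smoothMetric M a' r₁).val y) ∧ (∀ [(Literature.Geometry.Lorentzian.Kerr.smoothMetric M a' r₁).HasLeviCivita] (y : Literature.Geometry.Lorentzian.Kerr.slice a' r₁), (Literature.Geometry.Lorentzian.pullbackBilin (I := 𝓡 3) (I' := 𝓘(ℝ, Literature.Geometry.Lorentzian.E3)) φ (C).k y).toLinearMap₁₂ = (Literature.Geometry.Lorentzian.Kerr.smoothMetric M a' r₁).secondFundamentalForm 𝓘(ℝ, Literature.Geometry.Lorentzian.E3) ψ ν y) := by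
  intro inst M a σ σ₄ c rb rc hM τ ϱ α ϱinv X Ω Ψ N C ha hrbm hrbp _hrc0 hrcb hσ0 hσ4 _hτs hϱs hαs hgraph hinv1
    hinv2 hinvs hX hΩ hΨ hsp hNs hN hCh hCk
  -- parameters
  have hrb0 : 0 < rb := (Negative.rMinus_nonneg ha).trans_lt hrbm
  have hσ₄0 : 0 < σ₄ := hσ0.trans hσ4
  have hmemΩ : ∀ {u : E3}, u ∈ Ω ↔ σ < ‖u‖ := fun {u} ↦ by rw [← SetLike.mem_coe, hΩ]; rfl
  have hmem : ∀ {y : E3}, y ∈ Kerr.slice a rb ↔ rb < Kerr.radius a (E4.ofTimeSpace 0 y) := fun {y} ↦ by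
    rw [Kerr.mem_slice, max_eq_left hrb0.le]
  have hrad : ∀ y : Kerr.slice a rb, rb < Kerr.radius a (E4.ofTimeSpace 0 (y : E3)) := fun y ↦ hmem.1 y.2
  have hrpos : ∀ y : Kerr.slice a rb, 0 < Kerr.radius a (E4.ofTimeSpace 0 (y : E3)) := fun y ↦ hrb0.trans (hrad y)
  have hspos : ∀ y : Kerr.slice a rb, σ₄ < ϱinv (Kerr.radius a (E4.ofTimeSpace 0 (y : E3))) := fun y ↦
    (hinv2 _ (hrad y)).1
  -- the end chart `φ(x⃗) = ϱ⁻¹(r) · Rot_z(−α(ϱ⁻¹ r)) ℓ⃗(x⃗)` (its representative on `E3`)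
  set φt : E3 → E3 := fun y ↦ ϱinv (Kerr.radius a (E4.ofTimeSpace 0 y)) •
    !₂[Real.cos (α (ϱinv (Kerr.radius a (E4.ofTimeSpace 0 y)))) * Kerr.nullSpatial a (E4.ofTimeSpace 0 y) 0 +
          Real.sin (α (ϱinv (Kerr.radius a (E4.ofTimeSpace 0 y)))) * Kerr.nullSpatial a (E4.ofTimeSpace 0 y) 1,
       -(Real.sin (α (ϱinv (Kerr.radius a (E4.ofTimeSpace 0 y)))) * Kerr.nullSpatial a (E4.ofTimeSpace 0 y) 0) +
          Real.cos (α (ϱinv (Kerr.radius a (E4.ofTimeSpace 0 y)))) * Kerr.nullSpatial a (E4.ofTimeSpace 0 y) 1,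
       Kerr.nullSpatial a (E4.ofTimeSpace 0 y) 2] with hφt_def
  have hφt : ∀ y : E3, φt y = ϱinv (Kerr.radius a (E4.ofTimeSpace 0 y)) •
      !₂[Real.cos (α (ϱinv (Kerr.radius a (E4.ofTimeSpace 0 y)))) * Kerr.nullSpatial a (E4.ofTimeSpace 0 y) 0 +
            Real.sin (α (ϱinv (Kerr.radius a (E4.ofTimeSpace 0 y)))) * Kerr.nullSpatial a (E4.ofTimeSpace 0 y) 1,
         -(Real.sin (α (ϱinv (Kerr.radius a (E4.ofTimeSpace 0 y)))) * Kerr.nullSpatial a (E4.ofTimeSpace 0 y) 0) +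
            Real.cos (α (ϱinv (Kerr.radius a (E4.ofTimeSpace 0 y)))) * Kerr.nullSpatial a (E4.ofTimeSpace 0 y) 1,
         Kerr.nullSpatial a (E4.ofTimeSpace 0 y) 2] := fun _ ↦ rfl
  obtain ⟨hrange, hemb, hsmooth⟩ :=
    KerrCap.capChart_topology hX hφt hrb0.le hσ₄0.le hϱs hαs hinv1 hinv2 hinvs
  have hnorm : ∀ y : Kerr.slice a rb, ‖φt y‖ = ϱinv (Kerr.radius a (E4.ofTimeSpace 0 (y : E3))) := fun y ↦
    KerrCap.norm_capChart hφt (hrpos y) (hσ₄0.trans (hspos y)).le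
  have hφΩ : ∀ y : Kerr.slice a rb, φt y ∈ Ω := fun y ↦ hmemΩ.2 (by rw [hnorm y]; exact hσ4.trans (hspos y))
  have hXφ : ∀ y : Kerr.slice a rb, X (φt y) = y := fun y ↦
    KerrCap.capMap_capChart hX hφt (hrpos y) (hσ₄0.trans (hspos y)) (hinv2 _ (hrad y)).2
  have hτφ : ∀ y : Kerr.slice a rb,
      τ ‖φt y‖ = Negative.bentHeight M a (Kerr.radius a (E4.ofTimeSpace 0 (y : E3))) + c := fun y ↦ by
    rw [hnorm y, (hgraph _ (hspos y).le).1, (hinv2 _ (hrad y)).2]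
  have hφd : ∀ y : Kerr.slice a rb, DifferentiableAt ℝ φt y := fun y ↦
    (KerrCap.contDiffAt_capChart hφt hαs (hrpos y) (hinvs.contDiffAt (Ioi_mem_nhds (hrad y)))).differentiableAt
      (by simp)
  have hdφ : ∀ (y : Kerr.slice a rb) (u : E3),
      mfderiv 𝓘(ℝ, E3) (𝓡 3) (fun y : Kerr.slice a rb ↦ φt y) y u = fderiv ℝ φt y u := fun y u ↦ by
    rw [OpensChart.mfderiv_eq y (fun y : Kerr.slice a rb ↦ φt y) φt (fun _ ↦ rfl) (hφd y)]
    rfl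
  -- the lifted chart `φ' : slice → Ω` and the cap map
  set φ' : Kerr.slice a rb → Ω := fun y ↦ ⟨φt y, hφΩ y⟩ with hφ'_def
  have hφ'rep : ∀ y : Kerr.slice a rb, ((φ' y : Ω) : E3) = φt y := fun _ ↦ rfl
  set ΦΨ : E3 → E4 := fun u ↦ E4.ofTimeSpace (τ ‖u‖) (X u) with hΦΨ_def
  have hΨrep : ∀ u : Ω, (Ψ u : E4) = ΦΨ u := hΨ
  have hΨd : ∀ u : Ω, MDifferentiableAt 𝓘(ℝ, E3) 𝓘(ℝ, E4) Ψ u := fun u ↦ (hsp.1 u).mdifferentiableAt (by simp)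
  have hΦΨd : ∀ u : Ω, DifferentiableAt ℝ ΦΨ u := fun u ↦ OpensChart.differentiableAt_of_repr hΨrep (hΨd u)
  have hNd : ∀ u : Ω, DifferentiableAt ℝ N u := fun u ↦
    (hNs.contDiffAt (Ω.isOpen.mem_nhds u.2)).differentiableAt (by simp)
  have hNφd : ∀ y : Kerr.slice a rb, DifferentiableAt ℝ (N ∘ φt) y := fun y ↦ by
    have h1 : DifferentiableAt ℝ N (φt y) := hNd (φ' y)
    exact h1.comp (y : E3) (hφd y)
  have hFd : ∀ y : Kerr.slice a rb, MDifferentiableAt 𝓘(ℝ, E3) 𝓘(ℝ, E4) (Ψ ∘ φ') y := fun y ↦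
    KerrCap.mdifferentiableAt_comp_of_repr hφ'rep (hφd y) (hΨd _)
  -- the pinned graph, read in the two charts `Kerr.region a r_b`, `Kerr.region a r_c`
  have hgsp := Negative.isSpacelikeImmersion_graph ha rb
  set graphRep : E3 → E4 := fun z ↦ E4.ofTimeSpace (Negative.bentHeight M a (Kerr.radius a (E4.ofTimeSpace 0 z))) z
    with hgraphRep_def
  have hG : ∀ y : Kerr.slice a rb, (Negative.graph M a rb y : E4) = graphRep y := fun _ ↦ rfl
  have hgraphd : ∀ y : Kerr.slice a rb, DifferentiableAt ℝ graphRep y := fun y ↦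
    OpensChart.differentiableAt_of_repr hG ((hgsp.1 y).mdifferentiableAt (by simp))
  set Gc : Kerr.slice a rb → Kerr.region a rc := fun y ↦
    ⟨(Negative.graph M a rb y : E4), Kerr.region_mono a hrcb (Negative.graph M a rb y).2⟩ with hGc_def
  have hGc : ∀ y : Kerr.slice a rb, (Gc y : E4) = graphRep y := fun _ ↦ rfl
  have hGcd : ∀ y : Kerr.slice a rb, MDifferentiableAt 𝓘(ℝ, E3) 𝓘(ℝ, E4) Gc y := fun y ↦
    OpensChart.mdifferentiableAt_of_repr hGc (hgraphd y)
  -- `Ψ ∘ φ = ψ + c ∂_{t*}`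
  have hF : ∀ y : Kerr.slice a rb, (((Ψ ∘ φ') y : Kerr.region a rc) : E4) = Gc y + c • E4.basisVector 0 := by
    intro y
    rw [Function.comp_apply, hΨ, hGc]
    show E4.ofTimeSpace (τ ‖φt y‖) (X (φt y)) = graphRep y + c • E4.basisVector 0
    rw [hτφ y, hXφ y, KerrCap.ofTimeSpace_add_eq]
  have hF' : ∀ y : Kerr.slice a rb, ((Gc y : Kerr.region a rc) : E4) = (Ψ ∘ φ') y + (-c) • E4.basisVector 0 :=
    fun y ↦ by rw [hF y, neg_smul, add_neg_cancel_right]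
  -- the field `N ∘ φ` is the future unit normal of the graph, hence `= graphNormal`
  have hν₁ : (Kerr.smoothMetric M a rc).IsFutureUnitNormal 𝓘(ℝ, E3) ((Kerr.timeOrientation M a rc hM).ofLE le_top)
      (Ψ ∘ φ') (fun z ↦ (fun u ↦ N u) (φ' z)) :=
    KerrCap.isFutureUnitNormal_comp hφ'rep hφd hΨd hN
  have hν₂ : (Kerr.smoothMetric M a rc).IsFutureUnitNormal 𝓘(ℝ, E3) ((Kerr.timeOrientation M a rc hM).ofLE le_top)
      Gc (fun y ↦ N (φt y)) :=
    Kerr.isFutureUnitNormal_timeTranslate hF' hM (ν := fun z ↦ (fun u ↦ N u) (φ' z)) (ν' := fun y ↦ N (φt y))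
      (fun _ ↦ rfl) hFd hν₁
  have hν₃ : (Kerr.smoothMetric M a rb).IsFutureUnitNormal 𝓘(ℝ, E3) ((Kerr.timeOrientation M a rb hM).ofLE le_top)
      (Negative.graph M a rb) (fun y ↦ N (φt y)) :=
    KerrCap.isFutureUnitNormal_kerrChart hGc hG hM hgraphd (ν := fun y ↦ N (φt y)) (ν' := fun y ↦ N (φt y))
      (fun _ ↦ rfl) hν₂
  have hdim : Module.finrank ℝ E4 = Module.finrank ℝ E3 + 1 := by
    rw [finrank_euclideanSpace_fin, finrank_euclideanSpace_fin]
  have hνeq : (fun y : Kerr.slice a rb ↦ N (φt y)) = Negative.graphNormal M a rb :=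
    LorentzianMetric.IsFutureUnitNormal.unique hdim hgsp (Negative.isFutureUnitNormal_graphNormal ha rb hM) hν₃
  -- assemble the block
  refine ⟨a, rb, hM, Negative.bentHeight M a, fun y ↦ φt y, Negative.graph M a rb, Negative.graphNormal M a rb, ha,
    hrbm, hrbp, Negative.bentHeight_eq_literal M a, ?_, hemb, hsmooth, fun _ ↦ rfl, hgsp,
    Negative.isFutureUnitNormal_graphNormal ha rb hM, fun y ↦ ?_, ?_⟩
  · -- compact complement `closedBall 0 σ₄`
    have hcompl : (Set.range fun y : Kerr.slice a rb ↦ φt y)ᶜ = Metric.closedBall (0 : E3) σ₄ := by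
      rw [hrange]
      ext u
      simp [Metric.mem_closedBall, dist_zero_right, not_lt]
    rw [hcompl]
    exact isCompact_closedBall 0 σ₄
  · -- the pull-back identity for `h`
    have step : ∀ v w : E3, pullbackBilin (I := 𝓡 3) (I' := 𝓘(ℝ, E3)) (fun y : Kerr.slice a rb ↦ φt y) C.h.inner y v w =
        pullbackBilin (I := 𝓘(ℝ, E4)) (I' := 𝓘(ℝ, E3)) (Ψ ∘ φ') (Kerr.smoothMetric M a rc).val y v w := by
      intro v w
      rw [pullbackBilin_apply, pullbackBilin_apply, hdφ y v, hdφ y w,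
        KerrCap.mfderiv_comp_of_repr hφ'rep (hφd y) (hΨd _) v, KerrCap.mfderiv_comp_of_repr hφ'rep (hφd y) (hΨd _) w]
      exact hCh (φ' y) _ _
    ext v w
    rw [step v w, Kerr.pullbackBilin_timeTranslate hF (hGcd y), KerrCap.pullbackBilin_kerrChart_eq hGc hG (hgraphd y)]
  · -- the pull-back identity for `k`
    intro _ y
    haveI hLC : (Kerr.smoothMetric M a rc).HasLeviCivita :=
      (Kerr.smoothMetric M a rc).toPseudoRiemannianMetric.hasLeviCivita
    refine LinearMap.ext fun v ↦ LinearMap.ext fun w ↦ ?_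
    have hlhs : (pullbackBilin (I := 𝓡 3) (I' := 𝓘(ℝ, E3)) (fun y : Kerr.slice a rb ↦ φt y) C.k y).toLinearMap₁₂ v w =
        C.k (φt y) (mfderiv 𝓘(ℝ, E3) (𝓡 3) (fun y : Kerr.slice a rb ↦ φt y) y v)
          (mfderiv 𝓘(ℝ, E3) (𝓡 3) (fun y : Kerr.slice a rb ↦ φt y) y w) := rfl
    have e1 : C.k (φt y) (fderiv ℝ φt y v) (fderiv ℝ φt y w) =
        (Kerr.smoothMetric M a rc).secondFundamentalForm 𝓘(ℝ, E3) Ψ (fun u ↦ N u) (φ' y) (fderiv ℝ φt y v)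
          (fderiv ℝ φt y w) := hCk (φ' y) _ _
    have e2 := KerrCap.secondFundamentalForm_comp_of_repr hφ'rep (g := (Kerr.smoothMetric M a rc).toPseudoRiemannianMetric)
      (Kerr.smoothMetric_val_eq_bilin M a rc) hΨrep
      (ν := fun u ↦ N u) (N := N) (fun _ ↦ rfl) (hφd y) (hΦΨd (φ' y)) (hNd (φ' y))
      (Kerr.differentiableAt_bilin M a _) v w
    have e3 := Kerr.secondFundamentalForm_timeTranslate (M := M) (f := Gc) (f' := Ψ ∘ φ') hF (Φ := graphRep) hGc
      (ν := fun y ↦ N (φt y)) (ν' := fun z ↦ (fun u ↦ N u) (φ' z)) (N := N ∘ φt) (fun _ ↦ rfl) (fun _ ↦ rfl)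
      (hgraphd y) (hNφd y)
    have e4 := KerrCap.secondFundamentalForm_kerrChart_eq (M := M) hGc hG (ν := fun y ↦ N (φt y))
      (ν' := fun y ↦ N (φt y)) (N := N ∘ φt) (fun _ ↦ rfl) (fun _ ↦ rfl) (hgraphd y) (hNφd y) v w
    rw [hlhs, hdφ y v, hdφ y w, e1, ← e2, e3, e4, hνeq]

/-- **Registered export of this file** (sub-goal `cap_shield` of the crux item): the statement of `stub_capShield`
with the namespace `Literature.Geometry.Lorentzian` opened and the model-with-corners arguments of `pullbackBilin`
given positionally (the registered one-line form of the stub), an immediate consequence of `stub_capShield`.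
[cite: ONeill1983, Ch. 4, Lemma 4.4] -/
theorem cap_shield :
    ∀ [Kerr.Facts] (M a σ σ₄ c rb rc : ℝ) (hM : 0 ≤ M) (τ ϱ α ϱinv : ℝ → ℝ) (X : E3 → E3) (Ω : Opens E3) (Ψ : Ω → Kerr.region a rc) (N : E3 → E4) (C : InitialDataSet (𝓡 3) E3), |a| < M → Kerr.rMinus M a < rb → rb < Kerr.rPlus M a → 0 ≤ rc → rc ≤ rb → 0 < σ → σ < σ₄ → ContDiff ℝ ∞ τ → ContDiff ℝ ∞ ϱ → ContDiff ℝ ∞ α → (∀ s, σ₄ ≤ s → τ s = Negative.bentHeight M a (ϱ s) + c ∧ 0 < deriv ϱ s) → (∀ s, σ₄ < s → rb < ϱ s ∧ ϱinv (ϱ s) = s) → (∀ r, rb < r → σ₄ < ϱinv r ∧ ϱ (ϱinv r) = r) → ContDiffOn ℝ ∞ ϱinv (Set.Ioi rb) → (∀ u : E3, X u = !₂[(ϱ ‖u‖ * (Real.cos (α ‖u‖) * u 0 - Real.sin (α ‖u‖) * u 1) - a * (Real.sin (α ‖u‖) * u 0 + Real.cos (α ‖u‖) * u 1)) / ‖u‖,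 (ϱ ‖u‖ * (Real.sin (α ‖u‖) * u 0 + Real.cos (α ‖u‖) * u 1) + a * (Real.cos (α ‖u‖) * u 0 - Real.sin (α ‖u‖) * u 1)) / ‖u‖, ϱ ‖u‖ * u 2 / ‖u‖]) → (Ω : Set E3) = {u : E3 | σ < ‖u‖} → (∀ u : Ω, (Ψ u : E4) = E4.ofTimeSpace (τ ‖(u : E3)‖) (X u)) → (Kerr.smoothMetric M a rc).IsSpacelikeImmersion 𝓘(ℝ, E3) Ψ → ContDiffOn ℝ ∞ N Ω → (Kerr.smoothMetric M a rc).IsFutureUnitNormal 𝓘(ℝ, E3) ((Kerr.timeOrientation M a rc hM).ofLE le_top) Ψ (fun u ↦ N u) → (∀ (u : Ω) (v w : E3), C.h.inner (u : E3) v w = (Kerr.smoothMetric M a rc).inducedBilin 𝓘(ℝ, E3) Ψ u v w) → (∀ [(Kerr.smoothMetric M a rc).HasLeviCivita] (u : Ω) (v w : E3), C.k (u : E3) v w = (Kerr.smoothMetric M a rc).secondFundamentalForm 𝓘(ℝ, E3) Ψ (fun u ↦ N u) u v w) → ∃ (a' r₁ : ℝ) (hM' : 0 ≤ M) (T : ℝ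 → ℝ) (φ : Kerr.slice a' r₁ → E3) (ψ : Kerr.slice a' r₁ → Kerr.region a' r₁) (ν : NormalField 𝓘(ℝ, E4) ψ), |a'| < M ∧ Kerr.rMinus M a' < r₁ ∧ r₁ < Kerr.rPlus M a' ∧ T = (fun r : ℝ => Real.smoothTransition (r / (4 * M) - 1) * (((M) / Real.sqrt ((M) ^ 2 - (a') ^ 2)) * (Kerr.rPlus M a' * Real.log (r - Kerr.rPlus M a') - Kerr.rMinus M a' * Real.log (r - Kerr.rMinus M a')) - ((M) / Real.sqrt ((M) ^ 2 - (a') ^ 2)) * (Kerr.rPlus M a' * Real.log ((4 * M) - Kerr.rPlus M a') - Kerr.rMinus M a' * Real.log ((4 * M) - Kerr.rMinus M a')))) ∧ IsCompact (Set.range φ)ᶜ ∧ Topology.IsOpenEmbedding φ ∧ ContMDiff 𝓘(ℝ, E3) (𝓡 3) ((⊤ : ℕ∞) : WithTop ℕ∞) φ ∧ (∀ y : Kerr.slice a' r₁, (ψ y : E4) = E4.ofTimeSpace (T (Kerr.radius a' (E4.ofTimeSpace 0 (y : E3)))) (y : E3)) ∧ (Kerr.smoothMetric M a' r₁).IsSpacelikeImmersion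 𝓘(ℝ, E3) ψ ∧ (Kerr.smoothMetric M a' r₁).IsFutureUnitNormal 𝓘(ℝ, E3) ((Kerr.timeOrientation M a' r₁ hM').ofLE le_top) ψ ν ∧ (∀ y : Kerr.slice a' r₁, @pullbackBilin E3 _ _ E3 _ (𝓡 3) E3 _ _ E3 _ _ E3 _ 𝓘(ℝ, E3) (Kerr.slice a' r₁) _ _ φ C.h.inner y = @pullbackBilin E4 _ _ E4 _ 𝓘(ℝ, E4) (Kerr.region a' r₁) _ _ E3 _ _ E3 _ 𝓘(ℝ, E3) (Kerr.slice a' r₁) _ _ ψ (Kerr.smoothMetric M a' r₁).val y) ∧ (∀ [(Kerr.smoothMetric M a' r₁).HasLeviCivita] (y : Kerr.slice a' r₁), (@pullbackBilin E3 _ _ E3 _ (𝓡 3) E3 _ _ E3 _ _ E3 _ 𝓘(ℝ, E3) (Kerr.slice a' r₁) _ _ φ C.k y).toLinearMap₁₂ = (Kerr.smoothMetric M a' r₁).secondFundamentalForm 𝓘(ℝ, E3) ψ ν y) :=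
  @stub_capShield

end Summit.FinalStateConjecture.FinalStateConjecture.Theorems.SwallowTheDatum

end
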